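import Literature.Analysis.FluidPDE.KinematicApexWitness
import Literature.Analysis.FluidPDE.WeakSpatialGradientSum
import Literature.Analysis.FluidPDE.LocalTypeI
import HarnessLib

/-!
# The kinematic SPREAD witness for Stub C of crux `TypeITraceScarL3` (stmt-NavierStokesRegularity-18385),
# part 1: the field, pointwise facts, smoothness, weak gradient

Negative-lane lemma file of the disprover seat `cdisprove-stmt-NavierStokesRegularity-18385` (`--supports` the
item).  The witness `U = V + W` — the tree's parabolic bump `V = apexVelocity` (`KinematicApexWitness`) plus its
TRAVELLING COPY `W(t, x) = V(t, x − c(t))`, `c(t) = (−t)⁻¹ e` — is assembled in `StubCFalseWithoutNS`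
(`exists_kinematic_spreadExtinctApex`: Stub C `stub_no_spreadExtinctApex` minus its Navier–Stokes clause is
FALSE).  This part: definitions, the rate `‖U‖ ≤ 2/√(−t)`, support geometry (`W = 0` near the origin for
`t ≥ −1/4`, `V = 0` at `c(t)`), smoothness on the open slab `t < 0`, the classical derivative `∇V + ∇W` and
the weak gradient on every `Q(a)` (clause (G)), elementary convexity bounds, pointwise indicator bounds for the
travelling copy, measurability of the slices, and `D = 0` for the zero pressure.  WHAT THIS IS NOT: not a
Navier–Stokes solution; not NS regularity (neither proved nor refuted here).  References: D. Albritton,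
T. Barker, Arch. Ration. Mech. Anal. 232 (2019), §1 [AlbrittonBarker2019]; G. Koch, N. Nadirashvili, G. Seregin,
V. Šverák, Acta Math. 203 (2009), (1.4) [KNSS2009].
-/

noncomputable section

set_option linter.dupNamespace false

namespace Summit.NavierStokesRegularity.NavierStokesRegularity.Theorems.TypeITraceScarL3.Negative

open MeasureTheory Set Function Filter Topology Metric TopologicalSpace
open Literature.Analysis.FluidPDE Literature.Analysis.FluidPDE.ParabolicBump
open scoped NNReal ENNReal InnerProductSpace RealInnerProductSpace

/-! ### The travelling bump and the witness -/

/-- The drift centre `c(t) = (−t)⁻¹ e`, escaping to spatial infinity as `t → 0⁻`. [folklore] -/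
def driftCentre (t : ℝ) : EuclideanSpace ℝ (Fin 3) := (-t)⁻¹ • parasiticDir

/-- The travelling copy `W(t, x) = V(t, x − c(t))` of the parabolic bump `V = apexVelocity`. [folklore] -/
def travelVelocity : ℝ → EuclideanSpace ℝ (Fin 3) → EuclideanSpace ℝ (Fin 3) :=
  fun t x => apexVelocity t (x - driftCentre t)

/-- Its classical spatial gradient `∇W(t, x) = ∇V(t, x − c(t))`. [folklore] -/
def travelGradient : ℝ → EuclideanSpace ℝ (Fin 3) →
    EuclideanSpace ℝ (Fin 3) →L[ℝ] EuclideanSpace ℝ (Fin 3) :=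
  fun t x => apexGradient t (x - driftCentre t)

/-- **The witness** `U = V + W`: the parabolic bump at the origin plus its travelling copy. [folklore] -/
def spreadVelocity : ℝ → EuclideanSpace ℝ (Fin 3) → EuclideanSpace ℝ (Fin 3) :=
  fun t x => apexVelocity t x + travelVelocity t x

/-- Its spatial gradient `∇V + ∇W`. [folklore] -/
def spreadGradient : ℝ → EuclideanSpace ℝ (Fin 3) →
    EuclideanSpace ℝ (Fin 3) →L[ℝ] EuclideanSpace ℝ (Fin 3) :=
  fun t x => apexGradient t x + travelGradient t x

/-! ### Pointwise facts -/

/-- The drift centre has norm `1/(−t)`. [folklore] -/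
theorem norm_driftCentre {t : ℝ} (ht : t < 0) : ‖driftCentre t‖ = (-t)⁻¹ := by
  rw [driftCentre, norm_smul, norm_parasiticDir, mul_one, Real.norm_eq_abs,
    abs_of_pos (inv_pos.2 (by linarith))]

/-- The bump has the rate `1/√(−t)`. [folklore] -/
theorem norm_apexVelocity_le (t : ℝ) (x : EuclideanSpace ℝ (Fin 3)) :
    ‖apexVelocity t x‖ ≤ 1 / Real.sqrt (-t) := by
  rw [norm_apexVelocity]; exact apexAmp_le t _

/-- So does its travelling copy. [folklore] -/
theorem norm_travelVelocity_le (t : ℝ) (x : EuclideanSpace ℝ (Fin 3)) :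
    ‖travelVelocity t x‖ ≤ 1 / Real.sqrt (-t) :=
  norm_apexVelocity_le t _

/-- The rate: `‖U(t, x)‖ ≤ 2/√(−t)`. [folklore] -/
theorem norm_spreadVelocity_le (t : ℝ) (x : EuclideanSpace ℝ (Fin 3)) :
    ‖spreadVelocity t x‖ ≤ 2 / Real.sqrt (-t) := by
  calc ‖spreadVelocity t x‖ ≤ ‖apexVelocity t x‖ + ‖travelVelocity t x‖ := norm_add_le _ _
    _ ≤ 1 / Real.sqrt (-t) + 1 / Real.sqrt (-t) :=
        add_le_add (norm_apexVelocity_le t x) (norm_travelVelocity_le t x)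
    _ = 2 / Real.sqrt (-t) := by ring

/-- The travelling copy vanishes off `B(c(t), 2√(−t))`. [folklore] -/
theorem travelVelocity_eq_zero_of {t : ℝ} (ht : t < 0) {x : EuclideanSpace ℝ (Fin 3)}
    (hx : 2 * Real.sqrt (-t) ≤ ‖x - driftCentre t‖) : travelVelocity t x = 0 :=
  apexVelocity_eq_zero_of ht hx

/-- For `−1/4 ≤ t < 0`: `2√(−t) ≤ 1 ≤ (−t)⁻¹ − 1/2`. [folklore] -/
theorem two_sqrt_le_of_late {t : ℝ} (ht : t < 0) (ht4 : -(1 / 4 : ℝ) ≤ t) :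
    2 * Real.sqrt (-t) ≤ 1 ∧ (4 : ℝ) ≤ (-t)⁻¹ := by
  have hnt : 0 < -t := by linarith
  refine ⟨?_, ?_⟩
  · have : Real.sqrt (-t) ≤ 1 / 2 := by
      rw [Real.sqrt_le_left (by norm_num)]
      linarith
    linarith
  · rw [le_inv_comm₀ (by norm_num) hnt]
    linarith

/-- For `−1/4 ≤ t < 0` and `‖x‖ ≤ 1/2` the travelling copy vanishes (`‖c(t)‖ = 1/(−t) ≥ 4`). [folklore] -/
theorem travelVelocity_eq_zero_near_origin {t : ℝ} (ht : t < 0) (ht4 : -(1 / 4 : ℝ) ≤ t)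
    {x : EuclideanSpace ℝ (Fin 3)} (hx : ‖x‖ ≤ 1 / 2) : travelVelocity t x = 0 := by
  apply travelVelocity_eq_zero_of ht
  obtain ⟨h1, h2⟩ := two_sqrt_le_of_late ht ht4
  have h3 : ‖driftCentre t‖ - ‖x‖ ≤ ‖x - driftCentre t‖ := by
    rw [← norm_neg (x - driftCentre t), neg_sub]; exact norm_sub_norm_le _ _
  rw [norm_driftCentre ht] at h3
  linarith

/-- For `−1/4 ≤ t < 0` the bump at the origin vanishes at the drift centre. [folklore] -/
theorem apexVelocity_driftCentre {t : ℝ} (ht : t < 0) (ht4 : -(1 / 4 : ℝ) ≤ t) :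
    apexVelocity t (driftCentre t) = 0 := by
  apply apexVelocity_eq_zero_of ht
  obtain ⟨h1, h2⟩ := two_sqrt_le_of_late ht ht4
  rw [norm_driftCentre ht]
  linarith

/-- At the drift centre the travelling copy has the full size `1/√(−t)`. [folklore] -/
theorem norm_travelVelocity_driftCentre {t : ℝ} (ht : t < 0) :
    ‖travelVelocity t (driftCentre t)‖ = 1 / Real.sqrt (-t) := by
  rw [travelVelocity, sub_self, norm_apexVelocity, apexAmp_eq_of ht]
  rw [norm_zero]; simp only [ne_eq, OfNat.ofNat_ne_zero, not_false_eq_true, zero_pow]; linarith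

/-- Hence `‖U(t, c(t))‖ = 1/√(−t)` for `−1/4 ≤ t < 0`. [folklore] -/
theorem norm_spreadVelocity_driftCentre {t : ℝ} (ht : t < 0) (ht4 : -(1 / 4 : ℝ) ≤ t) :
    ‖spreadVelocity t (driftCentre t)‖ = 1 / Real.sqrt (-t) := by
  rw [spreadVelocity, apexVelocity_driftCentre ht ht4, zero_add, norm_travelVelocity_driftCentre ht]

/-! ### Smoothness on the open slab `t < 0` and the classical derivative -/

/-- The drift is smooth in `t < 0` (jointly, as a function on the slab). [folklore] -/
theorem contDiffOn_shift {n : ℕ∞} :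
    ContDiffOn ℝ n (fun p : ℝ × EuclideanSpace ℝ (Fin 3) => (p.1, p.2 - driftCentre p.1))
      (Iio 0 ×ˢ univ) := by
  refine contDiffOn_fst.prodMk (contDiffOn_snd.sub ?_)
  have h1 : ContDiffOn ℝ n (fun p : ℝ × EuclideanSpace ℝ (Fin 3) => (-p.1)⁻¹) (Iio 0 ×ˢ univ) :=
    contDiffOn_fst.neg.inv fun p hp => by
      have : p.1 < 0 := hp.1
      linarith
  exact h1.smul contDiffOn_const

/-- The travelling copy is smooth on the open slab. [folklore] -/
theorem contDiffOn_travelVelocity {n : ℕ∞} :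
    ContDiffOn ℝ n (uncurry travelVelocity) (Iio 0 ×ˢ univ) := by
  have e : uncurry travelVelocity =
      uncurry apexVelocity ∘ fun p : ℝ × EuclideanSpace ℝ (Fin 3) => (p.1, p.2 - driftCentre p.1) := by
    funext p; rfl
  rw [e]
  exact contDiffOn_apexVelocity.comp contDiffOn_shift fun p hp => ⟨hp.1, mem_univ _⟩

/-- The witness is smooth on the open slab. [folklore] -/
theorem contDiffOn_spreadVelocity {n : ℕ∞} :
    ContDiffOn ℝ n (uncurry spreadVelocity) (Iio 0 ×ˢ univ) :=
  contDiffOn_apexVelocity.add contDiffOn_travelVelocity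

/-- Chain rule for the travelling copy. [folklore] -/
theorem hasFDerivAt_travelVelocity (t : ℝ) (x : EuclideanSpace ℝ (Fin 3)) :
    HasFDerivAt (travelVelocity t) (travelGradient t x) x := by
  have h1 : HasFDerivAt (apexVelocity t) (apexGradient t (x - driftCentre t)) (x - driftCentre t) := by
    rw [apexGradient, (hasFDerivAt_apexVelocity t (x - driftCentre t)).fderiv]
    exact hasFDerivAt_apexVelocity t _
  have h2 : HasFDerivAt (fun y : EuclideanSpace ℝ (Fin 3) => y - driftCentre t)
      (ContinuousLinearMap.id ℝ _) x := (hasFDerivAt_id x).sub_const _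
  have h3 := h1.comp x h2
  rw [ContinuousLinearMap.comp_id] at h3
  exact h3

/-- The witness has the classical derivative `∇V + ∇W`. [folklore] -/
theorem hasFDerivAt_spreadVelocity (t : ℝ) (x : EuclideanSpace ℝ (Fin 3)) :
    HasFDerivAt (spreadVelocity t) (spreadGradient t x) x := by
  have h1 : HasFDerivAt (apexVelocity t) (apexGradient t x) x := by
    rw [apexGradient, (hasFDerivAt_apexVelocity t x).fderiv]
    exact hasFDerivAt_apexVelocity t _
  exact h1.add (hasFDerivAt_travelVelocity t x)

/-- Hence `fderiv (U t) = ∇V + ∇W`. [folklore] -/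
theorem fderiv_spreadVelocity (t : ℝ) (x : EuclideanSpace ℝ (Fin 3)) :
    fderiv ℝ (spreadVelocity t) x = spreadGradient t x :=
  (hasFDerivAt_spreadVelocity t x).fderiv

/-- Each time slice of the bump is continuous. [folklore] -/
theorem continuous_apexVelocity (t : ℝ) : Continuous (apexVelocity t) :=
  continuous_iff_continuousAt.2 fun x => (hasFDerivAt_apexVelocity t x).continuousAt

/-- Each time slice of the travelling copy is continuous. [folklore] -/
theorem continuous_travelVelocity (t : ℝ) : Continuous (travelVelocity t) :=
  continuous_iff_continuousAt.2 fun x => (hasFDerivAt_travelVelocity t x).continuousAt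

/-! ### The weak gradient on every cylinder `Q(a)` at the origin -/

/-- Cylinders at the origin lie in the open lower half-space. [folklore] -/
theorem parabolicCylinder_subset_slab (a : ℝ) :
    parabolicCylinder a (0 : ℝ × EuclideanSpace ℝ (Fin 3)) ⊆ Iio 0 ×ˢ univ := by
  rintro ⟨t, x⟩ h
  rw [mem_parabolicCylinder] at h
  exact ⟨by simpa using h.1.2, mem_univ _⟩

/-- **(G)** The witness has the weak spatial gradient `∇V + ∇W` on every `Q(a)` at the origin. [folklore] -/
theorem spread_hasWeakSpatialGradientOn (a : ℝ) :
    HasWeakSpatialGradientOn (parabolicCylinderOpens a (0 : ℝ × EuclideanSpace ℝ (Fin 3)))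
      spreadVelocity spreadGradient := by
  have hQ : ((parabolicCylinderOpens a (0 : ℝ × EuclideanSpace ℝ (Fin 3)) :
      Opens (ℝ × EuclideanSpace ℝ (Fin 3))) : Set (ℝ × EuclideanSpace ℝ (Fin 3))) ⊆ Iio 0 ×ˢ univ := by
    rw [coe_parabolicCylinderOpens]; exact parabolicCylinder_subset_slab a
  have h := hasWeakSpatialGradientOn_of_contDiffOn (S := Iio 0) isOpen_Iio hQ
    (contDiffOn_spreadVelocity (n := 1))
  have e : (fun t x => fderiv ℝ (spreadVelocity t) x) = spreadGradient := by
    funext t x; exact fderiv_spreadVelocity t x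
  rw [e] at h
  exact h

/-! ### Elementary convexity bounds for sums -/

/-- `|a + b|² ≤ 2|a|² + 2|b|²` in `ℝ≥0∞`. [folklore] -/
theorem enorm_add_sq_le (a b : EuclideanSpace ℝ (Fin 3)) :
    ‖a + b‖ₑ ^ 2 ≤ 2 * ‖a‖ₑ ^ 2 + 2 * ‖b‖ₑ ^ 2 := by
  have h : ‖a + b‖ ^ 2 ≤ 2 * ‖a‖ ^ 2 + 2 * ‖b‖ ^ 2 := by
    nlinarith [norm_add_le a b, norm_nonneg (a + b), norm_nonneg a, norm_nonneg b,
      sq_nonneg (‖a‖ - ‖b‖)]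
  have h2 : ENNReal.ofReal (‖a + b‖ ^ 2) ≤ ENNReal.ofReal (2 * ‖a‖ ^ 2 + 2 * ‖b‖ ^ 2) :=
    ENNReal.ofReal_le_ofReal h
  rw [ENNReal.ofReal_add (by positivity) (by positivity), ENNReal.ofReal_mul (by norm_num : (0 : ℝ) ≤ 2),
    ENNReal.ofReal_mul (by norm_num : (0 : ℝ) ≤ 2), ENNReal.ofReal_ofNat] at h2
  rw [← ofReal_norm, ← ofReal_norm, ← ofReal_norm, ← ENNReal.ofReal_pow (norm_nonneg _),
    ← ENNReal.ofReal_pow (norm_nonneg _), ← ENNReal.ofReal_pow (norm_nonneg _)]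
  exact h2

/-- `|a + b|³ ≤ 4|a|³ + 4|b|³` in `ℝ≥0∞`. [folklore] -/
theorem enorm_add_cube_le (a b : EuclideanSpace ℝ (Fin 3)) :
    ‖a + b‖ₑ ^ (3 : ℕ) ≤ 4 * ‖a‖ₑ ^ (3 : ℕ) + 4 * ‖b‖ₑ ^ (3 : ℕ) := by
  have h : ‖a + b‖ ^ 3 ≤ 4 * ‖a‖ ^ 3 + 4 * ‖b‖ ^ 3 := by
    have h1 : ‖a + b‖ ^ 3 ≤ (‖a‖ + ‖b‖) ^ 3 :=
      pow_le_pow_left₀ (norm_nonneg _) (norm_add_le a b) 3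
    nlinarith [norm_nonneg a, norm_nonneg b, sq_nonneg (‖a‖ - ‖b‖),
      mul_nonneg (norm_nonneg a) (norm_nonneg b)]
  have h2 : ENNReal.ofReal (‖a + b‖ ^ 3) ≤ ENNReal.ofReal (4 * ‖a‖ ^ 3 + 4 * ‖b‖ ^ 3) :=
    ENNReal.ofReal_le_ofReal h
  rw [ENNReal.ofReal_add (by positivity) (by positivity), ENNReal.ofReal_mul (by norm_num : (0 : ℝ) ≤ 4),
    ENNReal.ofReal_mul (by norm_num : (0 : ℝ) ≤ 4), ENNReal.ofReal_ofNat] at h2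
  rw [← ofReal_norm, ← ofReal_norm, ← ofReal_norm, ← ENNReal.ofReal_pow (norm_nonneg _),
    ← ENNReal.ofReal_pow (norm_nonneg _), ← ENNReal.ofReal_pow (norm_nonneg _)]
  exact h2

/-- `|A + B|²_F ≤ 2|A|²_F + 2|B|²_F`. [folklore] -/
theorem frobeniusNormSq_add_le
    (A B : EuclideanSpace ℝ (Fin 3) →L[ℝ] EuclideanSpace ℝ (Fin 3)) :
    frobeniusNormSq (A + B) ≤ 2 * frobeniusNormSq A + 2 * frobeniusNormSq B := by
  unfold frobeniusNormSq
  rw [Finset.mul_sum, Finset.mul_sum, ← Finset.sum_add_distrib]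
  refine Finset.sum_le_sum fun i _ => ?_
  set a := A (stdOrthonormalBasis ℝ (EuclideanSpace ℝ (Fin 3)) i)
  set b := B (stdOrthonormalBasis ℝ (EuclideanSpace ℝ (Fin 3)) i)
  change ‖a + b‖ ^ 2 ≤ 2 * ‖a‖ ^ 2 + 2 * ‖b‖ ^ 2
  nlinarith [norm_add_le a b, norm_nonneg (a + b), norm_nonneg a, norm_nonneg b,
    sq_nonneg (‖a‖ - ‖b‖)]

/-- The Frobenius norm squared is nonnegative. [folklore] -/
theorem frobeniusNormSq_nonneg'
    (A : EuclideanSpace ℝ (Fin 3) →L[ℝ] EuclideanSpace ℝ (Fin 3)) : 0 ≤ frobeniusNormSq A := by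
  unfold frobeniusNormSq; positivity

/-- `|A + B|²_F ≤ 2|A|²_F + 2|B|²_F` in `ℝ≥0∞`. [folklore] -/
theorem ofReal_frobeniusNormSq_add_le
    (A B : EuclideanSpace ℝ (Fin 3) →L[ℝ] EuclideanSpace ℝ (Fin 3)) :
    ENNReal.ofReal (frobeniusNormSq (A + B)) ≤
      2 * ENNReal.ofReal (frobeniusNormSq A) + 2 * ENNReal.ofReal (frobeniusNormSq B) := by
  have hA := frobeniusNormSq_nonneg' A
  have hB := frobeniusNormSq_nonneg' B
  have h2 : ENNReal.ofReal (frobeniusNormSq (A + B)) ≤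
      ENNReal.ofReal (2 * frobeniusNormSq A + 2 * frobeniusNormSq B) :=
    ENNReal.ofReal_le_ofReal (frobeniusNormSq_add_le A B)
  rw [ENNReal.ofReal_add (by positivity) (by positivity), ENNReal.ofReal_mul (by norm_num : (0 : ℝ) ≤ 2),
    ENNReal.ofReal_mul (by norm_num : (0 : ℝ) ≤ 2), ENNReal.ofReal_ofNat] at h2
  exact h2

/-! ### Slice bounds for a bump centred anywhere -/

/-- Pointwise: `|W(t,x)|² ≤ (−t)⁻¹ 𝟙_{B(c(t), 2√(−t))}`. [folklore] -/
theorem enorm_sq_travel_le {t : ℝ} (ht : t < 0) (x : EuclideanSpace ℝ (Fin 3)) :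
    ‖travelVelocity t x‖ₑ ^ 2 ≤
      (ball (driftCentre t) (2 * Real.sqrt (-t))).indicator (fun _ => ENNReal.ofReal (1 / (-t))) x := by
  have h := enorm_sq_apex_le ht (x - driftCentre t)
  by_cases hx : x ∈ ball (driftCentre t) (2 * Real.sqrt (-t))
  · have hx' : x - driftCentre t ∈ ball (0 : EuclideanSpace ℝ (Fin 3)) (2 * Real.sqrt (-t)) := by
      rw [mem_ball_zero_iff]; rwa [mem_ball_iff_norm] at hx
    rw [indicator_of_mem hx]; rw [indicator_of_mem hx'] at h; exact h
  · have hx' : x - driftCentre t ∉ ball (0 : EuclideanSpace ℝ (Fin 3)) (2 * Real.sqrt (-t)) := by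
      rw [mem_ball_zero_iff]; rwa [mem_ball_iff_norm] at hx
    rw [indicator_of_notMem hx]; rw [indicator_of_notMem hx'] at h; exact h

/-- Pointwise: `|W(t,x)|³ ≤ (−t)^{−3/2} 𝟙_{B(c(t), 2√(−t))}`. [folklore] -/
theorem enorm_cube_travel_le {t : ℝ} (ht : t < 0) (x : EuclideanSpace ℝ (Fin 3)) :
    ‖travelVelocity t x‖ₑ ^ (3 : ℕ) ≤
      (ball (driftCentre t) (2 * Real.sqrt (-t))).indicator
        (fun _ => ENNReal.ofReal ((1 / Real.sqrt (-t)) ^ 3)) x := by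
  have h := enorm_cube_apex_le ht (x - driftCentre t)
  by_cases hx : x ∈ ball (driftCentre t) (2 * Real.sqrt (-t))
  · have hx' : x - driftCentre t ∈ ball (0 : EuclideanSpace ℝ (Fin 3)) (2 * Real.sqrt (-t)) := by
      rw [mem_ball_zero_iff]; rwa [mem_ball_iff_norm] at hx
    rw [indicator_of_mem hx]; rw [indicator_of_mem hx'] at h; exact h
  · have hx' : x - driftCentre t ∉ ball (0 : EuclideanSpace ℝ (Fin 3)) (2 * Real.sqrt (-t)) := by
      rw [mem_ball_zero_iff]; rwa [mem_ball_iff_norm] at hx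
    rw [indicator_of_notMem hx]; rw [indicator_of_notMem hx'] at h; exact h

/-- Pointwise: `|∇W(t,x)|²_F ≤ 48L²/(−t)² 𝟙_{B(c(t), 2√(−t))}`. [folklore] -/
theorem frob_travelGradient_le {L : ℝ} (hL0 : 0 ≤ L) (hL : ∀ s, |deriv cutoff s| ≤ L)
    {t : ℝ} (ht : t < 0) (x : EuclideanSpace ℝ (Fin 3)) :
    ENNReal.ofReal (frobeniusNormSq (travelGradient t x)) ≤
      (ball (driftCentre t) (2 * Real.sqrt (-t))).indicator
        (fun _ => ENNReal.ofReal (48 * L ^ 2 / (-t) ^ 2)) x := by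
  have h := frobeniusNormSq_apexGradient_le hL0 hL ht (x - driftCentre t)
  rw [travelGradient]
  by_cases hx : x ∈ ball (driftCentre t) (2 * Real.sqrt (-t))
  · have hx' : x - driftCentre t ∈ ball (0 : EuclideanSpace ℝ (Fin 3)) (2 * Real.sqrt (-t)) := by
      rw [mem_ball_zero_iff]; rwa [mem_ball_iff_norm] at hx
    rw [indicator_of_mem hx]; rw [indicator_of_mem hx'] at h; exact h
  · have hx' : x - driftCentre t ∉ ball (0 : EuclideanSpace ℝ (Fin 3)) (2 * Real.sqrt (-t)) := by
      rw [mem_ball_zero_iff]; rwa [mem_ball_iff_norm] at hx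
    rw [indicator_of_notMem hx]; rw [indicator_of_notMem hx'] at h; exact h

/-! ### Slice bounds for the witness `U = V + W` -/

/-- Measurability of `|V(t)|²`. [folklore] -/
theorem measurable_enorm_apex_sq (t : ℝ) :
    Measurable fun x : EuclideanSpace ℝ (Fin 3) => ‖apexVelocity t x‖ₑ ^ 2 :=
  (continuous_apexVelocity t).measurable.enorm.pow_const _

/-- Measurability of `|V(t)|³`. [folklore] -/
theorem measurable_enorm_apex_cube (t : ℝ) :
    Measurable fun x : EuclideanSpace ℝ (Fin 3) => ‖apexVelocity t x‖ₑ ^ (3 : ℕ) :=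
  (continuous_apexVelocity t).measurable.enorm.pow_const _

/-- Each time slice of `∇V` is continuous (for `t ≥ 0` the bump is `0`). [folklore] -/
theorem continuous_apexGradient (t : ℝ) : Continuous (apexGradient t) := by
  have hc : ContinuousOn (fun q : ℝ × EuclideanSpace ℝ (Fin 3) => fderiv ℝ (apexVelocity q.1) q.2)
      (Iio (0 : ℝ) ×ˢ univ) :=
    continuousOn_fderiv_slice_of_contDiffOn (contDiffOn_apexVelocity (n := 1)) isOpen_Iio.uniqueDiffOn
  by_cases ht : t < 0
  · have e : apexGradient t = (fun q : ℝ × EuclideanSpace ℝ (Fin 3) => fderiv ℝ (apexVelocity q.1) q.2) ∘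
        fun x => (t, x) := by funext x; rfl
    rw [e]
    exact hc.comp_continuous (Continuous.prodMk_right t) fun x => ⟨ht, mem_univ _⟩
  · -- for `t ≥ 0` the bump is identically zero (`√(−t) = 0`), so its gradient is `0`
    have hz : apexVelocity t = fun _ => 0 := by
      funext x
      rw [apexVelocity_eq]
      have : Real.sqrt (-t) = 0 := Real.sqrt_eq_zero'.2 (by linarith)
      simp [this]
    have e : apexGradient t = fun _ => 0 := by
      funext x; rw [apexGradient, hz]; exact fderiv_const_apply 0
    rw [e]; exact continuous_const

/-- Measurability of `|∇V(t)|²_F`. [folklore] -/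
theorem measurable_frob_apexGradient (t : ℝ) :
    Measurable fun x : EuclideanSpace ℝ (Fin 3) => ENNReal.ofReal (frobeniusNormSq (apexGradient t x)) :=
  (ENNReal.continuous_ofReal.comp (continuous_frobeniusNormSq₃.comp (continuous_apexGradient t))).measurable

/-! ### The pressure clause with `P = 0` -/

/-- `D(Q(z,r)) = 0` for the zero pressure. [folklore] -/
theorem cknD_zero (r : ℝ) (z : ℝ × EuclideanSpace ℝ (Fin 3)) :
    cknD r z (0 : ℝ → EuclideanSpace ℝ (Fin 3) → ℝ) = 0 := by
  unfold cknD
  simp [ENNReal.zero_rpow_of_pos (by norm_num : (0 : ℝ) < 3 / 2)]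

end Summit.NavierStokesRegularity.NavierStokesRegularity.Theorems.TypeITraceScarL3.Negative

end
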